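import Mathlib
import Literature.Probability.RandomMatrix.SphereCoordinateDensity

/-!
# Gaussian integrals over `ι → ℂ`: dilations and the radial moment identity

Helper file for route `BECHusimiAmplitudeGas`, support item `LaplaceCapUnion`
(stmt-AtomisticToContinuum-11995). All statements concern the standard Gaussian weight
`w(c) = exp(-∑ᵢ ‖cᵢ‖²)` on the coefficient space `ι → ℂ` with its product Lebesgue measure.

* `lintegral_comp_smul_pi`: `∫ f(s • c) dc = |s|^{-2|ι|} ∫ f` (the dimension count
  `finrank_real_pi_complex` is the tree's, `Literature/Probability/RandomMatrix`).
* `lintegral_gauss_dilate`: for `H` homogeneous of degree `2M`,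
  `∫ e^{-λ q(c)} H(c) dc = λ^{-(M+|ι|)} ∫ e^{-q(c)} H(c) dc` (`q(c) = ∑ᵢ ‖cᵢ‖²`).
* `lintegral_sum_norm_sq_mul_gauss`: the radial moment identity
  `∫ q(c) e^{-q(c)} G(c) dc = (N + |ι|) ∫ e^{-q(c)} G(c) dc` for `G` homogeneous of degree `2N`
  (polar integration replaced by the dilation identity integrated over `λ ∈ (1, ∞)` and Tonelli).
-/

noncomputable section

open MeasureTheory Set
open scoped ENNReal NNReal

namespace Summit.AtomisticToContinuum.BoseEinsteinCondensation.Theorems.LaplaceCapUnion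

variable {ι : Type*} [Fintype ι]

/-! ### The quadratic form `q(c) = ∑ᵢ ‖cᵢ‖²` -/

/-- `q(t • c) = t² q(c)`. [folklore] -/
theorem sum_norm_sq_smul (t : ℝ) (c : ι → ℂ) :
    ∑ i, ‖(t • c) i‖ ^ 2 = t ^ 2 * ∑ i, ‖c i‖ ^ 2 := by
  simp only [Pi.smul_apply, norm_smul, Real.norm_eq_abs, mul_pow, sq_abs, Finset.mul_sum]

/-- `0 ≤ q(c)`. [folklore] -/
theorem sum_norm_sq_nonneg (c : ι → ℂ) : 0 ≤ ∑ i, ‖c i‖ ^ 2 :=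
  Finset.sum_nonneg fun i _ => by positivity

/-- `q(c) = 0 ↔ c = 0`. [folklore] -/
theorem sum_norm_sq_eq_zero_iff (c : ι → ℂ) : ∑ i, ‖c i‖ ^ 2 = 0 ↔ c = 0 := by
  rw [Finset.sum_eq_zero_iff_of_nonneg fun i _ => by positivity]
  simp only [Finset.mem_univ, forall_const, ne_eq, OfNat.ofNat_ne_zero, not_false_eq_true,
    pow_eq_zero_iff, norm_eq_zero]
  exact Iff.symm funext_iff

/-- `0 < q(c)` for `c ≠ 0`. [folklore] -/
theorem sum_norm_sq_pos {c : ι → ℂ} (hc : c ≠ 0) : 0 < ∑ i, ‖c i‖ ^ 2 :=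
  lt_of_le_of_ne (sum_norm_sq_nonneg c) fun h => hc ((sum_norm_sq_eq_zero_iff c).1 h.symm)

/-- `q` is continuous. [folklore] -/
theorem continuous_sum_norm_sq : Continuous fun c : ι → ℂ => ∑ i, ‖c i‖ ^ 2 := by
  fun_prop

/-- The Gaussian weight `e^{-λ q}` is measurable (as an `ℝ≥0∞`-valued function). [folklore] -/
theorem measurable_gauss (la : ℝ) :
    Measurable fun c : ι → ℂ => ENNReal.ofReal (Real.exp (-(la * ∑ i, ‖c i‖ ^ 2))) :=
  (Real.continuous_exp.comp ((continuous_const.mul continuous_sum_norm_sq).neg)).measurable.ennreal_ofReal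

/-! ### Dilations -/

/-- Change of variables under a dilation of `ι → ℂ`:
`∫ f(s • c) dc = |s^{2|ι|}|⁻¹ ∫ f(c) dc` (`s ≠ 0`). [folklore] -/
theorem lintegral_comp_smul_pi (f : (ι → ℂ) → ℝ≥0∞) (hf : Measurable f) {s : ℝ} (hs : s ≠ 0) :
    ∫⁻ c, f (s • c) = ENNReal.ofReal (|(s ^ (2 * Fintype.card ι))⁻¹|) * ∫⁻ c, f c := by
  rw [← lintegral_map hf (measurable_const_smul s), Measure.map_addHaar_smul volume hs,
    lintegral_smul_measure, Literature.Probability.RandomMatrix.finrank_real_pi_complex,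
    smul_eq_mul]

/-- **Dilation identity.** If `H ≥ 0` is measurable and homogeneous of degree `2M`
(`H(t • c) = t^{2M} H(c)` for `t > 0`), then for `λ > 0`
`∫ e^{-λ q(c)} H(c) dc = λ^{-(M + |ι|)} ∫ e^{-q(c)} H(c) dc`. [folklore] -/
theorem lintegral_gauss_dilate (H : (ι → ℂ) → ℝ≥0∞) (hH : Measurable H) (M : ℕ)
    (hom : ∀ t : ℝ, 0 < t → ∀ c, H (t • c) = ENNReal.ofReal (t ^ (2 * M)) * H c)
    {la : ℝ} (hla : 0 < la) :
    ∫⁻ c, ENNReal.ofReal (Real.exp (-(la * ∑ i, ‖c i‖ ^ 2))) * H c =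
      ENNReal.ofReal ((la ^ (M + Fintype.card ι))⁻¹) *
        ∫⁻ c, ENNReal.ofReal (Real.exp (-(∑ i, ‖c i‖ ^ 2))) * H c := by
  have e1 : (fun c : ι → ℂ => ENNReal.ofReal (Real.exp (-(∑ i, ‖c i‖ ^ 2))) * H c) =
      fun c => ENNReal.ofReal (Real.exp (-(1 * ∑ i, ‖c i‖ ^ 2))) * H c := by
    funext c; rw [one_mul]
  rw [e1]
  set s : ℝ := Real.sqrt la with hs_def
  have hs : 0 < s := Real.sqrt_pos.2 hla
  have hs2 : s ^ 2 = la := Real.sq_sqrt hla.le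
  set f : (ι → ℂ) → ℝ≥0∞ := fun c => ENNReal.ofReal (Real.exp (-(1 * ∑ i, ‖c i‖ ^ 2))) * H c
    with hf_def
  have hf : Measurable f := (measurable_gauss 1).mul hH
  -- way 1: expand `f (s • c)` by homogeneity
  have h1 : ∫⁻ c, f (s • c) =
      ENNReal.ofReal (la ^ M) * ∫⁻ c, ENNReal.ofReal (Real.exp (-(la * ∑ i, ‖c i‖ ^ 2))) * H c := by
    have hm : Measurable fun c : ι → ℂ =>
        ENNReal.ofReal (Real.exp (-(la * ∑ i, ‖c i‖ ^ 2))) * H c := (measurable_gauss la).mul hH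
    rw [← lintegral_const_mul _ hm]
    refine lintegral_congr fun c => ?_
    simp only [hf_def, sum_norm_sq_smul, hom s hs, hs2, one_mul]
    have : s ^ (2 * M) = la ^ M := by rw [pow_mul, hs2]
    rw [this]
    ring
  -- way 2: change of variables
  have h2 : ∫⁻ c, f (s • c) = ENNReal.ofReal ((la ^ Fintype.card ι)⁻¹) * ∫⁻ c, f c := by
    rw [lintegral_comp_smul_pi f hf hs.ne']
    congr 2
    rw [pow_mul, hs2, abs_of_nonneg (inv_nonneg.2 (pow_nonneg hla.le _))]
  have hlaM : ENNReal.ofReal (la ^ M) ≠ 0 := by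
    rw [ENNReal.ofReal_ne_zero_iff]; positivity
  have key : ENNReal.ofReal (la ^ M) * ∫⁻ c, ENNReal.ofReal (Real.exp (-(la * ∑ i, ‖c i‖ ^ 2))) * H c
      = ENNReal.ofReal (la ^ M) * (ENNReal.ofReal ((la ^ (M + Fintype.card ι))⁻¹) * ∫⁻ c, f c) := by
    rw [← h1, h2, ← mul_assoc, ← ENNReal.ofReal_mul (pow_nonneg hla.le _)]
    congr 2
    rw [pow_add, mul_inv, ← mul_assoc, mul_inv_cancel₀ (pow_ne_zero _ hla.ne'), one_mul]
  exact (ENNReal.mul_right_inj hlaM ENNReal.ofReal_ne_top).1 key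


/-- The Gaussian weight `e^{-q}` is measurable. [folklore] -/
theorem measurable_gauss_one :
    Measurable fun c : ι → ℂ => ENNReal.ofReal (Real.exp (-(∑ i, ‖c i‖ ^ 2))) := by
  simpa only [one_mul] using (measurable_gauss (ι := ι) 1)

/-! ### Two one-dimensional integrals -/

/-- `∫_{(1,∞)} e^{-λ s} dλ = e^{-s}/s` for `s > 0`. [folklore] -/
theorem lintegral_Ioi_exp_neg_mul {s : ℝ} (hs : 0 < s) :
    ∫⁻ la in Ioi (1 : ℝ), ENNReal.ofReal (Real.exp (-(la * s))) =
      ENNReal.ofReal (Real.exp (-s) / s) := by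
  have ha : -s < 0 := by linarith
  have hint : IntegrableOn (fun x : ℝ => Real.exp (-s * x)) (Ioi 1) := integrableOn_exp_mul_Ioi ha 1
  have hval : ∫ x in Ioi (1 : ℝ), Real.exp (-s * x) = Real.exp (-s) / s := by
    rw [integral_exp_mul_Ioi ha 1, mul_one, neg_div_neg_eq]
  rw [← hval, ofReal_integral_eq_lintegral_ofReal hint
    (Filter.Eventually.of_forall fun x => (Real.exp_pos _).le)]
  refine setLIntegral_congr_fun measurableSet_Ioi fun x _ => ?_
  rw [show -(x * s) = -s * x by ring]

/-- `∫_{(1,∞)} λ^{-n} dλ = 1/(n-1)` for `n ≥ 2`. [folklore] -/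
theorem lintegral_Ioi_inv_pow {n : ℕ} (hn : 2 ≤ n) :
    ∫⁻ la in Ioi (1 : ℝ), ENNReal.ofReal ((la ^ n)⁻¹) = ENNReal.ofReal (1 / ((n : ℝ) - 1)) := by
  have h2 : (2 : ℝ) ≤ n := by exact_mod_cast hn
  have ha : (-(n : ℝ)) < -1 := by linarith
  have hint := integrableOn_Ioi_rpow_of_lt ha zero_lt_one
  have hval : ∫ t in Ioi (1 : ℝ), t ^ (-(n : ℝ)) = 1 / ((n : ℝ) - 1) := by
    rw [integral_Ioi_rpow_of_lt ha zero_lt_one, Real.one_rpow,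
      show (-(n : ℝ) + 1) = -((n : ℝ) - 1) by ring, neg_div_neg_eq]
  have hnn : 0 ≤ᵐ[volume.restrict (Ioi (1 : ℝ))] fun t : ℝ => t ^ (-(n : ℝ)) := by
    rw [Filter.EventuallyLE, ae_restrict_iff' measurableSet_Ioi]
    exact Filter.Eventually.of_forall fun t ht =>
      Real.rpow_nonneg (zero_le_one.trans (le_of_lt ht)) _
  rw [← hval, ofReal_integral_eq_lintegral_ofReal hint hnn]
  refine setLIntegral_congr_fun measurableSet_Ioi fun t ht => ?_
  rw [Real.rpow_neg (zero_le_one.trans (le_of_lt ht)), Real.rpow_natCast]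

/-! ### The radial moment identity -/

/-- **Radial moment identity.** For a measurable `G ≥ 0` on `ι → ℂ` (`ι` nonempty), homogeneous
of degree `2N` under real dilations, `∫ q(c) e^{-q(c)} G(c) dc = (N + |ι|) ∫ e^{-q(c)} G(c) dc`
where `q(c) = ∑ᵢ ‖cᵢ‖²`. (Classically: polar coordinates in `ℝ^{2|ι|}` and
`Γ(N+|ι|+1) = (N+|ι|) Γ(N+|ι|)`; here: the dilation identity integrated over `λ ∈ (1,∞)`
and Tonelli.) [folklore] -/
theorem lintegral_sum_norm_sq_mul_gauss [Nonempty ι] (G : (ι → ℂ) → ℝ≥0∞) (hG : Measurable G)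
    (N : ℕ) (hom : ∀ t : ℝ, 0 < t → ∀ c, G (t • c) = ENNReal.ofReal (t ^ (2 * N)) * G c) :
    ∫⁻ c, ENNReal.ofReal (∑ i, ‖c i‖ ^ 2) * (ENNReal.ofReal (Real.exp (-(∑ i, ‖c i‖ ^ 2))) * G c) =
      ((N : ℝ≥0∞) + Fintype.card ι) * ∫⁻ c, ENNReal.ofReal (Real.exp (-(∑ i, ‖c i‖ ^ 2))) * G c := by
  set d : ℕ := Fintype.card ι with hd_def
  have hd : 1 ≤ d := Fintype.card_pos
  -- `H := q · G`, homogeneous of degree `2(N+1)`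
  set H : (ι → ℂ) → ℝ≥0∞ := fun c => ENNReal.ofReal (∑ i, ‖c i‖ ^ 2) * G c with hH_def
  have hHm : Measurable H := continuous_sum_norm_sq.measurable.ennreal_ofReal.mul hG
  have homH : ∀ t : ℝ, 0 < t → ∀ c, H (t • c) = ENNReal.ofReal (t ^ (2 * (N + 1))) * H c := by
    intro t ht c
    simp only [hH_def, sum_norm_sq_smul, hom t ht c]
    rw [ENNReal.ofReal_mul (sq_nonneg t), show t ^ (2 * (N + 1)) = t ^ 2 * t ^ (2 * N) by ring,
      ENNReal.ofReal_mul (sq_nonneg t)]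
    ring
  -- the double integral `D = ∫_{λ>1} ∫_c e^{-λ q} H`
  set D : ℝ≥0∞ := ∫⁻ la in Ioi (1 : ℝ), ∫⁻ c, ENNReal.ofReal (Real.exp (-(la * ∑ i, ‖c i‖ ^ 2))) * H c
    with hD_def
  -- (i) evaluate via the dilation identity
  have hD1 : D = ENNReal.ofReal (1 / ((N : ℝ) + d)) *
      ∫⁻ c, ENNReal.ofReal (Real.exp (-(∑ i, ‖c i‖ ^ 2))) * H c := by
    have step : D = ∫⁻ la in Ioi (1 : ℝ), ENNReal.ofReal ((la ^ (N + 1 + d))⁻¹) *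
        ∫⁻ c, ENNReal.ofReal (Real.exp (-(∑ i, ‖c i‖ ^ 2))) * H c :=
      setLIntegral_congr_fun measurableSet_Ioi fun la hla =>
        lintegral_gauss_dilate H hHm (N + 1) homH (zero_lt_one.trans hla)
    have hm : Measurable fun la : ℝ => ENNReal.ofReal ((la ^ (N + 1 + d))⁻¹) :=
      ((continuous_pow _).measurable.inv).ennreal_ofReal
    rw [step, lintegral_mul_const _ hm, lintegral_Ioi_inv_pow (by omega)]
    congr 2
    push_cast
    ring
  -- (ii) evaluate via Tonelli
  have hD2 : D = ∫⁻ c, ENNReal.ofReal (Real.exp (-(∑ i, ‖c i‖ ^ 2))) * G c := by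
    have hmeas : Measurable (Function.uncurry fun (la : ℝ) (c : ι → ℂ) =>
        ENNReal.ofReal (Real.exp (-(la * ∑ i, ‖c i‖ ^ 2))) * H c) := by
      change Measurable fun p : ℝ × (ι → ℂ) =>
        ENNReal.ofReal (Real.exp (-(p.1 * ∑ i, ‖p.2 i‖ ^ 2))) * H p.2
      refine Measurable.mul (Measurable.ennreal_ofReal ?_) (hHm.comp measurable_snd)
      exact (Real.continuous_exp.comp ((continuous_fst.mul
        (continuous_sum_norm_sq.comp continuous_snd)).neg)).measurable
    rw [hD_def, lintegral_lintegral_swap hmeas.aemeasurable]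
    have h0 : ∀ᵐ c : ι → ℂ, c ≠ 0 := by
      have : ({0} : Set (ι → ℂ))ᶜ ∈ ae (volume : Measure (ι → ℂ)) :=
        compl_mem_ae_iff.2 (measure_singleton 0)
      filter_upwards [this] with c hc
      simpa using hc
    refine lintegral_congr_ae ?_
    filter_upwards [h0] with c hc
    have hq : 0 < ∑ i, ‖c i‖ ^ 2 := sum_norm_sq_pos hc
    have hm : Measurable fun la : ℝ => ENNReal.ofReal (Real.exp (-(la * ∑ i, ‖c i‖ ^ 2))) :=
      (Real.continuous_exp.comp ((continuous_id.mul continuous_const).neg)).measurable.ennreal_ofReal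
    rw [lintegral_mul_const _ hm, lintegral_Ioi_exp_neg_mul hq, hH_def]
    dsimp only
    rw [← mul_assoc, ← ENNReal.ofReal_mul (by positivity), div_mul_cancel₀ _ hq.ne']
  -- conclude
  have hX : ∫⁻ c, ENNReal.ofReal (∑ i, ‖c i‖ ^ 2) *
      (ENNReal.ofReal (Real.exp (-(∑ i, ‖c i‖ ^ 2))) * G c) =
      ∫⁻ c, ENNReal.ofReal (Real.exp (-(∑ i, ‖c i‖ ^ 2))) * H c :=
    lintegral_congr fun c => by simp only [hH_def]; ring
  have hNd : ((N : ℝ≥0∞) + d) * ENNReal.ofReal (1 / ((N : ℝ) + d)) = 1 := by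
    have hpos : (0 : ℝ) < (N : ℝ) + d := by positivity
    rw [one_div, ENNReal.ofReal_inv_of_pos hpos, ENNReal.ofReal_add (Nat.cast_nonneg N)
      (Nat.cast_nonneg d), ENNReal.ofReal_natCast, ENNReal.ofReal_natCast]
    exact ENNReal.mul_inv_cancel (by positivity) (by simp)
  rw [hX, ← hD2, hD1, ← mul_assoc, hNd, one_mul]

end Summit.AtomisticToContinuum.BoseEinsteinCondensation.Theorems.LaplaceCapUnion
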